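import Summits.CriticalPhenomena.PercolationContinuityZ3.Theorems.PercNearOneGluingNoHeavyLowerTailAntitheticHandleDualShift
import Summits.CriticalPhenomena.PercolationContinuityZ3.Theorems.PercNearOneGluingNoHeavyLowerTailAntitheticTransportShift
import Summits.CriticalPhenomena.PercolationContinuityZ3.Theorems.PercNearOneGluingNoHeavyLowerTailAntitheticConeMixedShift
import Summits.CriticalPhenomena.PercolationContinuityZ3.Theorems.PercNearOneGluingNoHeavyLowerTailAntitheticFan5Sep
import HarnessLib

/-!
# `NoHeavyLowerTail` (stmt-CriticalPhenomena-4575) — antithetic cluster pairs: **THEOREM F5H — THE 5-FAN (`K_{1,1,5}`) FROM ITS HUB PLUS A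
# HANDLE** to ANY vertex, all arm lengths (CONJECTURE Δ2 / the vertex antithetic inequality at `R = {x}`): ⊕ by an ORBIT-COMPRESSED
# SEPARABLE CERTIFICATE on 7 vertices (…AntitheticFan5Sep), the mixed events by THEOREM M1 (…AntitheticConeMixedShift) — the LAST fan:
# the 6-fan from its hub is NOT ⊕_shift (−46, HOME/MEMO-gen67.md §4(c)) (prim-hp-2 gen 67, MEMO §3, §5)

Support file (`--supports stmt-CriticalPhenomena-4575`, hull-port prover `prim-hp-2`, gen 67).  No definitions, no named facts, no sorries;
COMPUTATIONAL only through …AntitheticFan5Sep and one `decide`.  The 5-fan: `c 0 = s` and the hub `c 1 = P` both joined to the leaves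
`c 2, …, c 6` and to each other; every target `Q = c q` is `s` (empty event), the hub (`P = Q`) or a leaf (adjacent to `P`), so THEOREM M1
(cone hypothesis at every vertex: `s` is adjacent to all) supplies every mixed hypothesis STRUCTURALLY and no symmetry argument is needed;
(⊕)_shift of `(fan5, s, hub)` — 7 coordinates, beyond the kernel decider — is the certificate.
* `Antithetic.Fan5.handle_vertex_sum_nonneg` — **THEOREM F5H** (conclusion written with the two new pairs in the order `xz, xy` and the edge set
  of `H` bracketed `(E₀ ∪ arm) ∪ stub`).
[cite: VandenbergHaggstromKahn2005, §1 p. 6 ("Harris' inequality"), §1 p. 3 (open cluster `C_s`)]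
-/

noncomputable section

namespace Summit.CriticalPhenomena.PercolationContinuityZ3.Theorems

open Literature.Probability.Percolation
open scoped Classical

namespace Antithetic

namespace Fan5

variable {V : Type*} [Fintype V] {c : Fin 7 → V} (hc : Function.Injective c) {E₀ : Set (Sym2 V)}
  (hE₀ : E₀ = Sym2.map c '' ↑({s(0, 1), s(0, 2), s(0, 3), s(0, 4), s(0, 5), s(0, 6), s(1, 2), s(1, 3), s(1, 4), s(1, 5), s(1, 6)} :
    Finset (Sym2 (Fin 7))))
  {q : Fin 7} {u w : ℕ → V} {a b : ℕ}
  (hu0 : u 0 = c 1) (hw0 : w 0 = c q)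
  (hufresh : ∀ i, 0 < i → i ≤ a → ∀ f ∈ E₀ ∪ Cyc.edgeSet b w, u i ∈ f → f.IsDiag)
  (hwfresh : ∀ i, 0 < i → i ≤ b → ∀ f ∈ E₀, w i ∈ f → f.IsDiag)
  (huinj : ∀ i j, i ≤ a → j ≤ a → u i = u j → i = j) (hwinj : ∀ i j, i ≤ b → j ≤ b → w i = w j → i = j)
  (hsu : ∀ i, 0 < i → i ≤ a → c 0 ≠ u i) (hsw : ∀ i, 0 < i → i ≤ b → c 0 ≠ w i)
  (hPw : ∀ i, 0 < i → i ≤ b → c 1 ≠ w i) (hzu : ∀ i, 0 < i → i ≤ a → w b ≠ u i)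
include hc hE₀ hu0 hw0 hufresh hwfresh huinj hwinj hsu hsw hPw hzu

/-- **THEOREM F5H (5-fan from the hub + handle to any vertex, all arm lengths).**  The 5-fan on `c 0 = s`, `c 1 = h` (hub = `P`) and the
leaves `c 2, …, c 6` (`c` injective, image edge set `E₀`), a handle from `P = c 1` to `Q = c q` (ANY `q : Fin 7`; arms `u 0 = c 1, …, u a = y`,
`w 0 = c q, …, w b = z` of fresh vertices), `x` fresh joined to `y, z`, `yz ∉ H = E₀ ∪ arms`.  Then for all monotone `F, G`:
`0 ≤ Σ_{ω : ¬(x ∈ X_E ω ∧ x ∈ Y_E ω)} (F(X_E ω) − F(Y_E ω))·(G(X_E ω) − G(Y_E ω))`, `E = H + xz + xy`. [this work] -/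
theorem handle_vertex_sum_nonneg {x : V}
    (hx : ∀ f ∈ (E₀ ∪ Cyc.edgeSet a u) ∪ Cyc.edgeSet b w, x ∈ f → f.IsDiag)
    (hxs : x ≠ c 0) (hxy : x ≠ u a) (hxz : x ≠ w b) (hyz : u a ≠ w b) (hg : s(u a, w b) ∉ (E₀ ∪ Cyc.edgeSet a u) ∪ Cyc.edgeSet b w)
    {F G : Set V → ℝ} (hF : Monotone F) (hG : Monotone G) :
    0 ≤ ∑ ω ∈ Finset.univ.filter (fun ω : Set (Sym2 V) =>
        ¬ ((openGraph (ω ∩ insert s(x, w b) (insert s(x, u a) ((E₀ ∪ Cyc.edgeSet a u) ∪ Cyc.edgeSet b w)))).Reachable (c 0) x ∧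
          (openGraph (ωᶜ ∩ insert s(x, w b) (insert s(x, u a) ((E₀ ∪ Cyc.edgeSet a u) ∪ Cyc.edgeSet b w)))).Reachable (c 0) x)),
      (F (openCluster (ω ∩ insert s(x, w b) (insert s(x, u a) ((E₀ ∪ Cyc.edgeSet a u) ∪ Cyc.edgeSet b w))) (c 0)) -
          F (openCluster (ωᶜ ∩ insert s(x, w b) (insert s(x, u a) ((E₀ ∪ Cyc.edgeSet a u) ∪ Cyc.edgeSet b w))) (c 0))) *
        (G (openCluster (ω ∩ insert s(x, w b) (insert s(x, u a) ((E₀ ∪ Cyc.edgeSet a u) ∪ Cyc.edgeSet b w))) (c 0)) -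
          G (openCluster (ωᶜ ∩ insert s(x, w b) (insert s(x, u a) ((E₀ ∪ Cyc.edgeSet a u) ∪ Cyc.edgeSet b w))) (c 0))) := by
  -- (inserts in the order `xz, xy` and `H = (E₀ ∪ arm) ∪ stub`; the shifted dual handle theorem writes `xy, xz` and `stub ∪ (arm ∪ E₀)`)
  have hcomm : (E₀ ∪ Cyc.edgeSet a u) ∪ Cyc.edgeSet b w = Cyc.edgeSet b w ∪ (Cyc.edgeSet a u ∪ E₀) := by
    rw [Set.union_comm E₀, Set.union_comm _ (Cyc.edgeSet b w)]
  rw [hcomm] at hx hg ⊢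
  rw [Set.insert_comm]
  -- no loops
  have hK : ∀ e ∈ ({s(0, 1), s(0, 2), s(0, 3), s(0, 4), s(0, 5), s(0, 6), s(1, 2), s(1, 3), s(1, 4), s(1, 5), s(1, 6)} : Finset (Sym2 (Fin 7))),
      ¬ e.IsDiag := by decide
  have hnd : ∀ f ∈ E₀, ¬ f.IsDiag := by
    intro f hf
    rw [hE₀] at hf
    obtain ⟨e, he, rfl⟩ := hf
    have hne := hK e (Finset.mem_coe.1 he)
    induction e using Sym2.ind with
    | h i j =>
      rw [Sym2.map_mk, Sym2.mk_isDiag_iff]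
      rw [Sym2.mk_isDiag_iff] at hne
      exact fun h => hne (hc h)
  -- (⊕)_shift from the certificate, transported along `c`
  have hop : ∀ Fp Fm Gp Gm : Set V → ℝ, Monotone Fp → Monotone Fm → (∀ S, Fm S ≤ Fp S) →
      Monotone Gp → Monotone Gm → (∀ S, Gm S ≤ Gp S) →
      0 ≤ ∑ T ∈ Finset.univ.filter (fun T : Set (Sym2 V) => c 1 ∈ openCluster (T ∩ E₀) (c 0)),
        (Fp (openCluster (T ∩ E₀) (c 0)) - Fm (openCluster (Tᶜ ∩ E₀) (c 0))) *
          (Gp (openCluster (T ∩ E₀) (c 0)) - Gm (openCluster (Tᶜ ∩ E₀) (c 0))) :=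
    fun Fp Fm Gp Gm hFp hFm hF' hGp hGm hG' =>
      TransportShift.oplus_of_powerset hc _ 0 1
        (fun Lp Lm Mp Mm hLp hLm hL hMp hMm hM => by
          convert oplus_shift_powerset Lp Lm Mp Mm hLp hLm hL hMp hMm hM using 10)
        hE₀ Fp Fm Gp Gm hFp hFm hF' hGp hGm hG'
  -- pairs of the image edge set, and the cone hypothesis at every vertex `c q'`, `q' ≠ 0`
  have hmem : ∀ i j : Fin 7, s(i, j) ∈ ({s(0, 1), s(0, 2), s(0, 3), s(0, 4), s(0, 5), s(0, 6), s(1, 2), s(1, 3), s(1, 4), s(1, 5), s(1, 6)} :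
      Finset (Sym2 (Fin 7))) → s(c i, c j) ∈ E₀ := fun i j h => by rw [hE₀]; exact ⟨s(i, j), Finset.mem_coe.2 h, Sym2.map_mk _ _ _⟩
  have hcone : ∀ q' : Fin 7, q' ≠ 0 → ∀ T : Set (Sym2 V), c 0 ∉ openCluster (Tᶜ ∩ E₀) (c q') →
      ∀ v ∈ openCluster (Tᶜ ∩ E₀) (c q'), s(c 0, v) ∈ E₀ := by
    intro q' hq'
    refine TwoStage.Cone.hcone_of_cone E₀ (c 0) (c q') (Set.range c \ {c 0}) ?_ ⟨⟨q', rfl⟩, fun h => hq' (hc h)⟩ ?_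
    · intro e he v hv
      rw [hE₀] at he
      obtain ⟨e', -, rfl⟩ := he
      induction e' using Sym2.ind with
      | h i j =>
        rw [Sym2.map_mk] at hv
        by_cases hv0 : v = c 0
        · exact Or.inl hv0
        · refine Or.inr ⟨?_, hv0⟩
          rcases Sym2.mem_iff.1 hv with rfl | rfl
          · exact ⟨i, rfl⟩
          · exact ⟨j, rfl⟩
    · rintro v ⟨⟨i, rfl⟩, hi⟩
      have hi0 : i ≠ 0 := fun h => hi (by rw [h]; rfl)
      have hsp : ∀ i : Fin 7, i ≠ 0 → s(0, i) ∈ ({s(0, 1), s(0, 2), s(0, 3), s(0, 4), s(0, 5), s(0, 6), s(1, 2), s(1, 3), s(1, 4), s(1, 5), s(1, 6)} :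
          Finset (Sym2 (Fin 7))) := by decide
      exact hmem 0 i (hsp i hi0)
  -- (M)_shift at every target: empty for `q = 0`, THEOREM M1 otherwise (`c 1 = c q` or `c 1 ~ c q`)
  have hmix : ∀ Fp Fm Gp Gm : Set V → ℝ, Monotone Fp → Monotone Fm → (∀ S, Fm S ≤ Fp S) →
      Monotone Gp → Monotone Gm → (∀ S, Gm S ≤ Gp S) →
      0 ≤ ∑ T ∈ Finset.univ.filter (fun T : Set (Sym2 V) =>
          c 1 ∈ openCluster (T ∩ E₀) (c 0) ∧ c q ∉ openCluster (Tᶜ ∩ E₀) (c 0)),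
        (Fp (openCluster (T ∩ E₀) (c 0)) - Fm (openCluster (Tᶜ ∩ E₀) (c 0))) *
          (Gp (openCluster (T ∩ E₀) (c 0)) - Gm (openCluster (Tᶜ ∩ E₀) (c 0))) := by
    intro Fp Fm Gp Gm hFp hFm hF' hGp hGm hG'
    by_cases hq0 : q = 0
    · refine Finset.sum_nonneg fun T hT => ?_
      rw [hq0] at hT
      exact absurd (mem_openCluster_self _ _) (Finset.mem_filter.1 hT).2.2
    have hPQ : c 1 = c q ∨ s(c 1, c q) ∈ E₀ := by
      by_cases hq1 : q = 1
      · exact Or.inl (by rw [hq1])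
      · have hedge : ∀ q : Fin 7, q ≠ 0 → q ≠ 1 → s(1, q) ∈ ({s(0, 1), s(0, 2), s(0, 3), s(0, 4), s(0, 5), s(0, 6), s(1, 2), s(1, 3), s(1, 4),
            s(1, 5), s(1, 6)} : Finset (Sym2 (Fin 7))) := by decide
        exact Or.inr (hmem 1 q (hedge q hq0 hq1))
    exact TwoStage.Cone.mixed_shift_nonneg E₀ (c 0) (c 1) (c q) (hcone q hq0) hPQ Fp Fm Gp Gm hFp hFm hF' hGp hGm hG'
  have h := Pendant.handle_vertex_sum_nonneg_of_oplus_shift hnd hwfresh hwinj hsw hPw hop hu0 hw0 hufresh huinj hsu hzu hmix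
    hx hxs hxy hxz hyz hg hF hG
  convert h using 3

end Fan5

end Antithetic

end Summit.CriticalPhenomena.PercolationContinuityZ3.Theorems
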